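import Literature.NumberTheory.LFunctions.SiegelZeroFormSumAsymptoticTheoremOneConsequences
import Literature.NumberTheory.LFunctions.SiegelZeroFormSumRegulatorBound
import Literature.NumberTheory.LFunctions.SiegelZeroClassNumberAllConductors
import Literature.NumberTheory.LFunctions.GreatestRealZeroElementary
import Mathlib.Analysis.SpecialFunctions.Pow.Asymptotics
import HarnessLib

/-!
# Goldfeld–Schinzel 1975: the Corollary, BOTH halves — `goldfeldSchinzel1975_corollary` PROVED

Topic `Literature/NumberTheory/LFunctions` (namespace `Literature.NumberTheory.LFunctions`, auxiliary
lemmas in `GoldfeldSchinzel1975`). PROOF LAYER (theorems only: no definitions, no new named facts;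
net debt −1) for the statement file `SiegelZeroFormSumAsymptotic.lean` (Goldfeld–Schinzel, Ann. Scuola
Norm. Sup. Pisa (4) **2** (1975) 571–583 [GoldfeldSchinzel1975]; cell `parity-realchar`, SIEGEL
INSTRUMENT, conditionals column I.17; cross-ladder literature-typing seat `littype-FP2-1`).

The statement file's `goldfeldSchinzel1975_corollary` is the conjunction, for every `η > 0` and all
primitive quadratic `χ` mod `D > c(η)` and EVERY real `β` with `L(β, χ) = 0`, of
`χ odd → (6/π − η)/√D ≤ 1 − β` and `χ even → (6/π² − η) log D/√D ≤ 1 − β`. The odd half is the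
tree's `GoldfeldSchinzel1975.corollary_odd` (`SiegelZeroFormSumAsymptoticTheoremOneConsequences.lean`,
from `goldfeldSchinzel1975_theorem1_holds`). This file proves the EVEN half by the printed deduction
of §4, p. 583:

> "For `d > 0` we have `L(1, χ) = h₀ log ε₀/√d` and we get from (19) and Theorem 2
> `1 − β ≥ (6/π²)(h₀ log ε₀/√d)(h₀ log ε₀/log(½√d − 1) + 4h₀/√d)⁻¹(1 − η/2) > (6/π² − η) log d/√d`."

with the inputs: Theorem 1 (`goldfeldSchinzel1975_theorem1_holds`); the class number formula
`L(1, χ) = 2h_K R_K/√D` for the real quadratic field with `d_K = D`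
(`SiegelZeroClassNumber.lOne_re_eq_of_even`, `SiegelZeroClassNumber.exists_field_of_even`); and, in
place of "Theorem 2 summed over the `h₀` proper classes of forms" (`h₀ log ε₀ = 2h_K R_K`), the tree's
ideal-side bound `Σ' 1/a ≤ h_K R_K/log(½√D − 1)`
(`GoldfeldSchinzel1975.formSum_le_classNumber_mul_regulator_div`, `SiegelZeroFormSumRegulatorBound.lean`),
so that the main term `M = (6/π²)L(1,χ)/Σ' 1/a ≥ (12/π²) log(½√D − 1)/√D` (`mainTerm_ge_even`). The
bookkeeping — zeros outside the window of Theorem 1 (`β ≤ 1 − c₁/log D`), "we can assume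
`1 − β < (log d)⁻²`", and `log(½√D − 1) ≥ ½ log D − log 4` — is absorbed into `c(η)` exactly as in
the tree's odd half (`corollary_odd_of_theorem1`): `(log D)²/√D, (log D)³/√D, (log log D)²/log D → 0`,
`log D → ∞`.

Main results: `GoldfeldSchinzel1975.corollary_even_of_theorem1`, `GoldfeldSchinzel1975.corollary_even`,
the discharge **`goldfeldSchinzel1975_corollary_holds : goldfeldSchinzel1975_corollary`**, and the
reading in Tao–Teräväinen's vocabulary `GoldfeldSchinzel1975.IsSiegelZero.quality_le_even` (a Siegel
zero of quality `η` of an even character mod `D > c(ε)` has `η ≤ √D/((6/π² − ε)(log D)²)`); the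
upper-bound reading `GoldfeldSchinzel1975.one_sub_le_classNumber_mul_regulator` (`1 − β ≤ (12/π² + η)
h_K R_K/√D` for the window zero); and the even-character halves of Pintz's Theorem 3 / Schinzel's
footnote (`pintz1976_theorem3_even`, `pintz1976_theorem3_schinzel_even`: every real zero of an even
primitive quadratic `χ` mod `D ≥ D₀(C)` is `> C/√D` away from `1`).

LABEL (cell rule): proof layer; 0 new definitions, 0 new facts; nothing here asserts that a Siegel
zero exists; nothing here bears on parity. No instances, no notation, standard axioms only.

## References

* [GoldfeldSchinzel1975] D. M. Goldfeld, A. Schinzel, *On Siegel's zero*, Ann. Scuola Norm. Sup. Pisa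
  Cl. Sci. (4) 2 (1975) 571–583: Theorem 1 (p. 571), Theorem 2 (pp. 571–572), Corollary (p. 572) and
  its proof §4 (pp. 582–583).
* [NeukirchANT1999] J. Neukirch, *Algebraic Number Theory*, Ch. VII §5 (5.11) (class number formula).
* [MontgomeryVaughan2007] H. L. Montgomery, R. C. Vaughan, *Multiplicative Number Theory I*, Thm. 9.13.
-/

noncomputable section

open Finset Filter Topology

namespace Literature.NumberTheory.LFunctions

open Literature.NumberTheory.QuadraticFields
open GoldfeldSchinzel1975

namespace GoldfeldSchinzel1975

/-! ### The main term for `d > 0`: `M ≥ (12/π²) log(½√D − 1)/√D` -/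

/-- A primitive character of level `q > 1` is not trivial. [folklore] -/
private theorem ne_one_of_isPrimitive' {q : ℕ} [NeZero q] {χ : DirichletCharacter ℂ q}
    (hχ : χ.IsPrimitive) (hq : 1 < q) : χ ≠ 1 := by
  rintro rfl
  rw [DirichletCharacter.isPrimitive_def, DirichletCharacter.conductor_one] at hχ
  omega

/-- **The main term of Theorem 1 for `d > 0`:** for an even primitive quadratic `χ` mod `D > 676` with
`Σ' 1/a ≠ 0`, `(6/π²) L(1,χ)/Σ' 1/a ≥ (6/π²)(2h_K R_K/√D)/(h_K R_K/log(½√D − 1)) = (12/π²) log(½√D − 1)/√D`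
(p. 583 with `h₀ log ε₀ = 2 h_K R_K` and the ideal-side Theorem 2).
[cite: GoldfeldSchinzel1975, §4 p. 583] [cite: NeukirchANT1999, Ch. VII §5 (5.11)] -/
theorem mainTerm_ge_even {D : ℕ} [NeZero D] {χ : DirichletCharacter ℂ D}
    (hprim : χ.IsPrimitive) (hquad : χ.IsQuadratic) (heven : χ.Even) (hD : 676 < D)
    (hF : formSum (D : ℤ) ≠ 0) :
    12 / Real.pi ^ 2 * Real.log (Real.sqrt D / 2 - 1) / Real.sqrt D ≤
      6 / Real.pi ^ 2 * (χ.LFunction 1).re / formSum (D : ℤ) := by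
  have hD1 : 1 < D := lt_trans (by norm_num) hD
  obtain ⟨K, _, _, h2, hdK⟩ := SiegelZeroClassNumber.exists_field_of_even hD1 hprim hquad heven
  have hre := SiegelZeroClassNumber.lOne_re_eq_of_even h2 hdK hD1 hprim hquad heven
  have hFle := formSum_le_classNumber_mul_regulator_div K h2 hdK hD
  have hF0 : 0 < formSum (D : ℤ) := lt_of_le_of_ne (formSum_nonneg _) (Ne.symm hF)
  have hD0 : (0 : ℝ) < D := by exact_mod_cast (lt_trans (by norm_num) hD : 0 < D)
  have hh : (0 : ℝ) < NumberField.classNumber K := by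
    exact_mod_cast NumberField.classNumber_pos (K := K)
  have hR : 0 < NumberField.Units.regulator K := NumberField.Units.regulator_pos K
  have hsqrt : 0 < Real.sqrt D := Real.sqrt_pos.mpr hD0
  have hsD : (26 : ℝ) < Real.sqrt D := by
    rw [show (26 : ℝ) = Real.sqrt (26 ^ 2) by rw [Real.sqrt_sq]; norm_num]
    exact Real.sqrt_lt_sqrt (by norm_num) (by exact_mod_cast (by omega : 26 ^ 2 < D))
  have hL : 0 < Real.log (Real.sqrt D / 2 - 1) := Real.log_pos (by linarith)
  have hπ := Real.pi_pos
  have hL0 : 0 ≤ (χ.LFunction 1).re := by rw [hre]; positivity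
  have hstep : 2 * Real.log (Real.sqrt D / 2 - 1) / Real.sqrt D ≤
      (χ.LFunction 1).re / formSum (D : ℤ) := by
    calc 2 * Real.log (Real.sqrt D / 2 - 1) / Real.sqrt D
        = (χ.LFunction 1).re / (NumberField.classNumber K * NumberField.Units.regulator K /
            Real.log (Real.sqrt D / 2 - 1)) := by
          rw [hre]; field_simp
      _ ≤ (χ.LFunction 1).re / formSum (D : ℤ) := div_le_div_of_nonneg_left hL0 hF0 hFle
  calc 12 / Real.pi ^ 2 * Real.log (Real.sqrt D / 2 - 1) / Real.sqrt D
      = 6 / Real.pi ^ 2 * (2 * Real.log (Real.sqrt D / 2 - 1) / Real.sqrt D) := by ring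
    _ ≤ 6 / Real.pi ^ 2 * ((χ.LFunction 1).re / formSum (D : ℤ)) := by gcongr
    _ = 6 / Real.pi ^ 2 * (χ.LFunction 1).re / formSum (D : ℤ) := by ring

/-! ### Real zeros are `< 1`; thresholds -/

/-- Every real zero of `L(s, χ)`, `χ ≠ 1`, has `β < 1`. [folklore] -/
private theorem lt_one_of_LFunction_eq_zero' {D : ℕ} [NeZero D] {χ : DirichletCharacter ℂ D}
    (hχ : χ ≠ 1) {β : ℝ} (hβ : χ.LFunction (β : ℂ) = 0) : β < 1 := by
  by_contra hle
  exact DirichletCharacter.LFunction_ne_zero_of_one_le_re χ (Or.inl hχ)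
    (by simpa using not_lt.mp hle) hβ

/-- From a real limit `f(x) → 0` (`x → ∞`) to a natural threshold. [folklore] -/
private theorem exists_nat_forall_lt_of_tendsto' {f : ℝ → ℝ} (hf : Tendsto f atTop (𝓝 0)) {ε : ℝ}
    (hε : 0 < ε) : ∃ N : ℕ, ∀ n : ℕ, N ≤ n → f n < ε := by
  have h := (hf.comp tendsto_natCast_atTop_atTop).eventually (eventually_lt_nhds hε)
  obtain ⟨N, hN⟩ := Filter.eventually_atTop.mp h
  exact ⟨N, fun n hn => hN n hn⟩

/-- `(log x)²/√x → 0`. [folklore] -/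
private theorem tendsto_log_sq_div_sqrt' :
    Tendsto (fun x : ℝ => Real.log x ^ 2 / Real.sqrt x) atTop (𝓝 0) := by
  have h := (isLittleO_log_rpow_rpow_atTop (2 : ℝ) (by norm_num : (0 : ℝ) < 1 / 2)).tendsto_div_nhds_zero
  refine h.congr' (Eventually.of_forall fun x => ?_)
  simp only [Real.sqrt_eq_rpow, Real.rpow_two]

/-- `(log x)³/√x → 0`. [folklore] -/
private theorem tendsto_log_cube_div_sqrt :
    Tendsto (fun x : ℝ => Real.log x ^ 3 / Real.sqrt x) atTop (𝓝 0) := by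
  have h := (isLittleO_log_rpow_rpow_atTop ((3 : ℕ) : ℝ) (by norm_num : (0 : ℝ) < 1 / 2)).tendsto_div_nhds_zero
  refine h.congr' (Eventually.of_forall fun x => ?_)
  simp only [Real.sqrt_eq_rpow, Real.rpow_natCast]

/-- `(log log x)²/log x + 1/log x → 0`. [folklore] -/
private theorem tendsto_loglog_sq_div_log_add_inv_log' :
    Tendsto (fun x : ℝ => Real.log (Real.log x) ^ 2 / Real.log x + (Real.log x)⁻¹) atTop (𝓝 0) := by
  have h1 := (Real.tendsto_pow_log_div_mul_add_atTop 1 0 2 one_ne_zero).comp Real.tendsto_log_atTop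
  have h2 := tendsto_inv_atTop_zero.comp Real.tendsto_log_atTop
  have h := h1.add h2
  rw [add_zero] at h
  refine h.congr' (Eventually.of_forall fun x => ?_)
  simp

/-- A natural threshold beyond which `log n > A`. [folklore] -/
private theorem exists_nat_forall_log_gt (A : ℝ) : ∃ N : ℕ, ∀ n : ℕ, N ≤ n → A < Real.log n := by
  have h := (Real.tendsto_log_atTop.comp tendsto_natCast_atTop_atTop).eventually_gt_atTop A
  obtain ⟨N, hN⟩ := Filter.eventually_atTop.mp h
  exact ⟨N, fun n hn => hN n hn⟩

/-! ### The Corollary for `d > 0`, from Theorem 1 -/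

-- the threshold bookkeeping is long: budgeted above the tree default on the buildfix lane's advice
set_option maxHeartbeats 400000 in
/-- **Goldfeld–Schinzel 1975, Corollary, case `d > 0`, DERIVED from Theorem 1** (§4 p. 583): modulo
the named fact `goldfeldSchinzel1975_theorem1` (PROVED in the tree), for every `η > 0` there is an
effective `c(η)` such that for every EVEN primitive quadratic `χ` mod `D > c(η)` and EVERY real zero `β`
of `L(s, χ)`, `(6/π² − η) log D/√D ≤ 1 − β`. For the zero of the window of Theorem 1 with
`1 − β < (log D)⁻²`: `1 − β ≥ M(1 − δ)`, `δ = π²η/12`, with `M ≥ (12/π²) log(½√D − 1)/√D`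
(`mainTerm_ge_even`) and `log(½√D − 1) ≥ ½ log D − log 4`; the other real zeros (`β ≤ 1 − c₁/log D`,
or `1 − β ≥ (log D)⁻²`, including the trivial zeros `β ≤ 0`) satisfy the bound trivially beyond an
effective threshold. [cite: GoldfeldSchinzel1975, Corollary p. 572 (case d > 0), proof §4 p. 583] -/
theorem corollary_even_of_theorem1 (h : goldfeldSchinzel1975_theorem1) {η : ℝ} (hη : 0 < η) :
    ∃ c : ℕ, ∀ (D : ℕ) [NeZero D], c < D →
      ∀ χ : DirichletCharacter ℂ D, χ.IsQuadratic → χ.IsPrimitive → χ.Even →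
        ∀ β : ℝ, χ.LFunction (β : ℂ) = 0 →
          (6 / Real.pi ^ 2 - η) * Real.log D / Real.sqrt D ≤ 1 - β := by
  obtain ⟨c₁, hc₁, C, D₀, hT⟩ := h
  have hπ := Real.pi_pos
  have hπ3 := Real.pi_gt_three
  set C' : ℝ := max C 0 with hC'
  have hC'0 : 0 ≤ C' := le_max_right _ _
  have hCC' : C ≤ C' := le_max_left _ _
  set δ : ℝ := Real.pi ^ 2 * η / 12 with hδ
  have hδ0 : 0 < δ := by positivity
  -- the thresholds
  obtain ⟨N₁, hN₁⟩ := exists_nat_forall_lt_of_tendsto' tendsto_log_sq_div_sqrt'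
    (by positivity : 0 < c₁ * Real.pi ^ 2 / 6)
  obtain ⟨N₂, hN₂⟩ := exists_nat_forall_lt_of_tendsto' tendsto_log_cube_div_sqrt
    (by positivity : 0 < Real.pi ^ 2 / 6)
  obtain ⟨N₃, hN₃⟩ := exists_nat_forall_lt_of_tendsto'
    (by simpa using tendsto_loglog_sq_div_log_add_inv_log'.const_mul C') hδ0
  obtain ⟨N₄, hN₄⟩ := exists_nat_forall_log_gt (24 * Real.log 4 / (Real.pi ^ 2 * η))
  refine ⟨max (max (max D₀ 676) N₁) (max (max N₂ N₃) N₄),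
    fun D _ hcD χ hquad hprim heven β hβ => ?_⟩
  simp only [max_lt_iff] at hcD
  obtain ⟨⟨⟨hD₀, hD676⟩, hD₁⟩, ⟨hD₂, hD₃⟩, hD₄⟩ := hcD
  have hD0 : (0 : ℝ) < D := by exact_mod_cast (lt_trans (by norm_num) hD676 : 0 < D)
  have hD1 : (1 : ℝ) < D := by exact_mod_cast (lt_trans (by norm_num) hD676 : 1 < D)
  have hsqrt : 0 < Real.sqrt D := Real.sqrt_pos.mpr hD0
  have hlog : 0 < Real.log D := Real.log_pos hD1
  have hsD : (26 : ℝ) < Real.sqrt D := by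
    rw [show (26 : ℝ) = Real.sqrt (26 ^ 2) by rw [Real.sqrt_sq]; norm_num]
    exact Real.sqrt_lt_sqrt (by norm_num) (by exact_mod_cast (by omega : 26 ^ 2 < D))
  -- `β < 1`
  have hχ1 : χ ≠ 1 := ne_one_of_isPrimitive' hprim (lt_trans (by norm_num) hD676)
  have hβ1 : β < 1 := lt_one_of_LFunction_eq_zero' hχ1 hβ
  -- trivial when `η ≥ 6/π²`
  set A : ℝ := 6 / Real.pi ^ 2 - η with hA
  by_cases hη' : 6 / Real.pi ^ 2 ≤ η
  · calc A * Real.log D / Real.sqrt D ≤ 0 :=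
          div_nonpos_of_nonpos_of_nonneg (mul_nonpos_of_nonpos_of_nonneg (by linarith) hlog.le)
            hsqrt.le
      _ ≤ 1 - β := by linarith
  replace hη' : η < 6 / Real.pi ^ 2 := not_le.mp hη'
  have hA0 : 0 < A := by rw [hA]; linarith
  have hA1 : A < 6 / Real.pi ^ 2 := by rw [hA]; linarith
  -- (E1) `A log D/√D < c₁/log D`, (E2) `A log D/√D < (log D)⁻²`
  have hE1 : A * Real.log D / Real.sqrt D ≤ c₁ / Real.log D := by
    have h1 := (hN₁ D hD₁.le).le
    -- `A (log D)² / √D ≤ (6/π²) (c₁ π²/6) = c₁`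
    rw [div_le_div_iff₀ hsqrt hlog]
    have h2 : Real.log D ^ 2 ≤ c₁ * Real.pi ^ 2 / 6 * Real.sqrt D := by
      rwa [div_le_iff₀ hsqrt] at h1
    have h3 : A * (Real.log D * Real.log D) ≤ 6 / Real.pi ^ 2 * (c₁ * Real.pi ^ 2 / 6 * Real.sqrt D) := by
      rw [← sq]
      exact mul_le_mul hA1.le h2 (by positivity) (by positivity)
    calc A * Real.log D * Real.log D = A * (Real.log D * Real.log D) := by ring
      _ ≤ 6 / Real.pi ^ 2 * (c₁ * Real.pi ^ 2 / 6 * Real.sqrt D) := h3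
      _ = c₁ * Real.sqrt D := by field_simp
  have hE2 : A * Real.log D / Real.sqrt D ≤ 1 / Real.log D ^ 2 := by
    have h1 := (hN₂ D hD₂.le).le
    rw [div_le_div_iff₀ hsqrt (by positivity)]
    have h2 : Real.log D ^ 3 ≤ Real.pi ^ 2 / 6 * Real.sqrt D := by
      rwa [div_le_iff₀ hsqrt] at h1
    have h3 : A * Real.log D ^ 3 ≤ 6 / Real.pi ^ 2 * (Real.pi ^ 2 / 6 * Real.sqrt D) :=
      mul_le_mul hA1.le h2 (by positivity) (by positivity)
    calc A * Real.log D * Real.log D ^ 2 = A * Real.log D ^ 3 := by ring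
      _ ≤ 6 / Real.pi ^ 2 * (Real.pi ^ 2 / 6 * Real.sqrt D) := h3
      _ = 1 * Real.sqrt D := by field_simp
  have hE3 : C' * (Real.log (Real.log D) ^ 2 / Real.log D + (Real.log D)⁻¹) ≤ δ :=
    (hN₃ D hD₃.le).le
  have hE4 : 24 * Real.log 4 / (Real.pi ^ 2 * η) < Real.log D := hN₄ D hD₄.le
  -- zeros outside the window of Theorem 1
  by_cases hwin : β ≤ 1 - c₁ / Real.log D
  · calc A * Real.log D / Real.sqrt D ≤ c₁ / Real.log D := hE1
      _ ≤ 1 - β := by linarith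
  replace hwin : 1 - c₁ / Real.log D < β := not_le.mp hwin
  -- "we can assume `1 − β < (log D)⁻²`"
  by_cases hsmall : 1 / Real.log D ^ 2 ≤ 1 - β
  · exact hE2.trans hsmall
  replace hsmall : 1 - β < 1 / Real.log D ^ 2 := not_le.mp hsmall
  -- Theorem 1 for this zero
  have key := hT D hD₀.le χ hquad hprim β hwin hβ1 hβ
  rw [signedDisc_of_not_odd heven.not_odd] at key
  set M : ℝ := 6 / Real.pi ^ 2 * (χ.LFunction 1).re / formSum (D : ℤ) with hM
  set ℓ : ℝ := Real.log (Real.log D) ^ 2 / Real.log D with hℓ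
  have hℓ0 : 0 ≤ ℓ := by positivity
  have hlow : M - M * C * (ℓ + (1 - β) * Real.log D) ≤ 1 - β := by
    have := (abs_le.mp key).1
    linarith
  by_cases hF : formSum (D : ℤ) = 0
  · -- `Σ' = 0`: then `M = 0` and Theorem 1 forces `β = 1`, impossible
    exfalso
    have hM0 : M = 0 := by rw [hM, hF, div_zero]
    rw [hM0] at key
    have h0 : |(1 - β) - 0| ≤ 0 := by simpa using key
    have : 1 - β = 0 := by
      have := abs_nonpos_iff.mp h0
      linarith
    linarith
  set L' : ℝ := Real.log (Real.sqrt D / 2 - 1) with hL'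
  have hL'0 : 0 < L' := Real.log_pos (by linarith)
  have hMge : 12 / Real.pi ^ 2 * L' / Real.sqrt D ≤ M := mainTerm_ge_even hprim hquad heven hD676 hF
  have hM0 : 0 ≤ M := le_trans (by positivity) hMge
  -- `(1 − β) log D ≤ 1/log D`
  have hprod : (1 - β) * Real.log D ≤ (Real.log D)⁻¹ := by
    have : (1 - β) * Real.log D < 1 / Real.log D ^ 2 * Real.log D :=
      mul_lt_mul_of_pos_right hsmall hlog
    rw [show 1 / Real.log D ^ 2 * Real.log D = (Real.log D)⁻¹ by field_simp] at this
    exact this.le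
  -- `M·C·(ℓ + (1−β) log D) ≤ M·δ`
  have herr : M * C * (ℓ + (1 - β) * Real.log D) ≤ M * δ := by
    have hnn : 0 ≤ ℓ + (1 - β) * Real.log D := by
      have : 0 ≤ (1 - β) * Real.log D := mul_nonneg (by linarith) hlog.le
      linarith
    calc M * C * (ℓ + (1 - β) * Real.log D) ≤ M * C' * (ℓ + (1 - β) * Real.log D) := by
          gcongr
      _ = M * (C' * (ℓ + (1 - β) * Real.log D)) := by ring
      _ ≤ M * (C' * (ℓ + (Real.log D)⁻¹)) := by gcongr
      _ ≤ M * δ := by gcongr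
  have hδ1 : δ ≤ 1 / 2 := by
    -- `δ = π² η/12 < π² (6/π²)/12 = 1/2`
    rw [hδ]
    have : Real.pi ^ 2 * η < Real.pi ^ 2 * (6 / Real.pi ^ 2) := by gcongr
    rw [show Real.pi ^ 2 * (6 / Real.pi ^ 2) = 6 by field_simp] at this
    linarith
  have hfac : 0 ≤ 1 - δ := by linarith
  -- `log(½√D − 1) ≥ ½ log D − log 4`
  have hL'ge : Real.log D / 2 - Real.log 4 ≤ L' := by
    have h1 : Real.sqrt D / 4 ≤ Real.sqrt D / 2 - 1 := by linarith
    have h2 : Real.log (Real.sqrt D / 4) ≤ L' := Real.log_le_log (by positivity) h1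
    have h3 : Real.log (Real.sqrt D / 4) = Real.log D / 2 - Real.log 4 := by
      rw [Real.log_div hsqrt.ne' (by norm_num), Real.log_sqrt hD0.le]
    linarith
  -- the final chain
  have hmain : A * Real.log D ≤ 12 / Real.pi ^ 2 * (1 - δ) * L' := by
    -- `(12/π²)(1 − δ) L' ≥ (12/π²)(1 − δ)(½ log D − log 4)` and
    -- `η log D ≥ (6/π²) δ log D + (12/π²)(1 − δ) log 4`, `(6/π²) δ = η/2`
    have hlog4 : 0 < Real.log 4 := Real.log_pos (by norm_num)
    have h1 : 12 / Real.pi ^ 2 * (1 - δ) * (Real.log D / 2 - Real.log 4) ≤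
        12 / Real.pi ^ 2 * (1 - δ) * L' :=
      mul_le_mul_of_nonneg_left hL'ge (by positivity)
    have h2 : 6 / Real.pi ^ 2 * δ = η / 2 := by rw [hδ]; field_simp; ring
    have h4 : 12 / Real.pi ^ 2 * Real.log 4 ≤ η / 2 * Real.log D := by
      -- from `24 log 4/(π² η) < log D`
      have e := hE4.le
      rw [div_le_iff₀ (by positivity)] at e
      rw [div_mul_eq_mul_div, div_le_iff₀ (by positivity)]
      linarith only [e]
    have h5 : 12 / Real.pi ^ 2 * (1 - δ) * Real.log 4 ≤ 12 / Real.pi ^ 2 * Real.log 4 := by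
      have : 12 / Real.pi ^ 2 * (1 - δ) * Real.log 4 = 12 / Real.pi ^ 2 * Real.log 4 * (1 - δ) := by
        ring
      rw [this]
      exact mul_le_of_le_one_right (by positivity) (by linarith)
    calc A * Real.log D = 6 / Real.pi ^ 2 * Real.log D - η * Real.log D := by rw [hA]; ring
      _ ≤ 6 / Real.pi ^ 2 * Real.log D - (6 / Real.pi ^ 2 * δ) * Real.log D -
            12 / Real.pi ^ 2 * (1 - δ) * Real.log 4 := by rw [h2]; linarith only [h4, h5]
      _ = 12 / Real.pi ^ 2 * (1 - δ) * (Real.log D / 2 - Real.log 4) := by ring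
      _ ≤ 12 / Real.pi ^ 2 * (1 - δ) * L' := h1
  calc A * Real.log D / Real.sqrt D ≤ 12 / Real.pi ^ 2 * (1 - δ) * L' / Real.sqrt D := by
        gcongr
    _ = 12 / Real.pi ^ 2 * L' / Real.sqrt D * (1 - δ) := by ring
    _ ≤ M * (1 - δ) := by gcongr
    _ = M - M * δ := by ring
    _ ≤ M - M * C * (ℓ + (1 - β) * Real.log D) := by linarith
    _ ≤ 1 - β := hlow

/-- **Corollary (`d > 0`) from Theorem 1, unconditionally**: for `η > 0` there is `c` with
`1 − β ≥ (6/π² − η) log D/√D` for every primitive quadratic EVEN `χ` mod `D > c` and every real zero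
`β` of `L(s, χ)`. [cite: GoldfeldSchinzel1975, Corollary p. 572 (case d > 0), proof §4 p. 583] -/
theorem corollary_even {η : ℝ} (hη : 0 < η) :
    ∃ c : ℕ, ∀ (D : ℕ) [NeZero D], c < D →
      ∀ χ : DirichletCharacter ℂ D, χ.IsQuadratic → χ.IsPrimitive → χ.Even →
        ∀ β : ℝ, χ.LFunction (β : ℂ) = 0 →
          (6 / Real.pi ^ 2 - η) * Real.log D / Real.sqrt D ≤ 1 - β :=
  corollary_even_of_theorem1 goldfeldSchinzel1975_theorem1_holds hη

/-- **The Corollary (`d > 0`) in Tao–Teräväinen's vocabulary, unconditionally**: for `ε > 0` with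
`6/π² − ε > 0` there is `c` such that for every `D > c` and every EVEN character `χ` mod `D`, a Siegel
zero `β = 1 − 1/(η log D)` of quality `η` of `χ` (Tao–Teräväinen's Definition 1.4: `χ` primitive
quadratic, `η ≥ 10`, `L(β, χ) = 0` — the column's `Literature.Barriers.Parity.IsSiegelZero χ η`) has
**`η ≤ √D/((6/π² − ε) (log D)²)`** — one logarithm better than the odd case
(`IsSiegelZero.quality_le_odd`: `√D/((6/π − ε) log D)`), reflecting the regulator in `L(1,χ) = 2h_K R_K/√D`.
[cite: GoldfeldSchinzel1975, Corollary p. 572 (case d > 0), §4 p. 583]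
[cite: TaoTeravainen2021, Definition 1.4] -/
theorem IsSiegelZero.quality_le_even {ε : ℝ} (hε : 0 < ε) (hε' : 0 < 6 / Real.pi ^ 2 - ε) :
    ∃ c : ℕ, ∀ (D : ℕ) [NeZero D], c < D → ∀ (χ : DirichletCharacter ℂ D) (η : ℝ), χ.Even →
      Literature.Barriers.Parity.IsSiegelZero χ η →
        η ≤ Real.sqrt D / ((6 / Real.pi ^ 2 - ε) * Real.log D ^ 2) := by
  obtain ⟨c, hc⟩ := corollary_even hε
  refine ⟨max c 2, fun D _ hD χ η heven hS => ?_⟩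
  obtain ⟨hcD, h2D⟩ := max_lt_iff.mp hD
  obtain ⟨hprim, hquad, h10, hz⟩ := hS
  have hD1 : (1 : ℝ) < D := by exact_mod_cast (lt_trans one_lt_two h2D)
  have hlog : 0 < Real.log D := Real.log_pos hD1
  have hη : 0 < η := by linarith
  have hηlog : 0 < η * Real.log D := by positivity
  have hb := hc D hcD χ hquad hprim heven _ hz
  have hsqrt : 0 < Real.sqrt D := Real.sqrt_pos.mpr (by positivity)
  have hb' : (6 / Real.pi ^ 2 - ε) * Real.log D / Real.sqrt D ≤ 1 / (η * Real.log D) := by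
    have hid : (1 : ℝ) - (1 - 1 / (η * Real.log D)) = 1 / (η * Real.log D) := by ring
    linarith
  rw [div_le_div_iff₀ hsqrt hηlog] at hb'
  rw [le_div_iff₀ (by positivity)]
  nlinarith

/-! ### The other direction for `d > 0`: `Σ' 1/a ≥ 1`, hence `1 − β ≤ (12/π² + η) h_K R_K/√D` -/

/-- **`Σ' 1/a ≥ 1` for `d = D > 16`, `D ≡ 0, 1 (mod 4)`**: the principal form `(1, b₀, (b₀² − D)/4)`,
`b₀ = 0` (`4 ∣ D`) or `b₀ = 1` (`D ≡ 1 (mod 4)`), has `−1 < b₀ ≤ 1 = a` and `16a² = 16 < D`, so it is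
counted in `Σ'` with weight `1`. [cite: GoldfeldSchinzel1975, Theorem 1 (2) p. 571]
[cite: Cox2013, §2.C (principal form)] -/
theorem one_le_formSum_pos {D : ℕ} (hD : 16 < D) (h4 : 4 ∣ (D : ℤ) ∨ (D : ℤ) % 4 = 1) :
    1 ≤ formSum (D : ℤ) := by
  have hnat : ((D : ℤ)).natAbs = D := by simp
  unfold formSum
  rw [hnat]
  have h1mem : (1 : ℕ) ∈ (Icc 1 D).filter (fun a : ℕ => 16 * a ^ 2 < D) := by
    simp only [Finset.mem_filter, Finset.mem_Icc]
    refine ⟨⟨le_rfl, by omega⟩, by simpa using hD⟩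
  have hterm : (1 : ℝ) ≤ (pairCount (D : ℤ) 1 : ℝ) / ((1 : ℕ) : ℝ) := by
    rw [Nat.cast_one, div_one, Nat.one_le_cast]
    unfold pairCount
    apply Finset.card_pos.mpr
    rcases h4 with h0 | h1
    · refine ⟨0, ?_⟩
      simp only [Finset.mem_filter, Finset.mem_Ioc, Nat.cast_one]
      refine ⟨⟨by norm_num, by norm_num⟩, ?_⟩
      simpa using h0
    · refine ⟨1, ?_⟩
      simp only [Finset.mem_filter, Finset.mem_Ioc, Nat.cast_one]
      refine ⟨⟨by norm_num, by norm_num⟩, ?_⟩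
      have : (4 : ℤ) ∣ 1 - (D : ℤ) := by omega
      simpa using this
  refine hterm.trans ?_
  exact Finset.single_le_sum (f := fun a : ℕ => (pairCount (D : ℤ) a : ℝ) / (a : ℝ))
    (fun a _ => by positivity) h1mem

/-- **The main term of Theorem 1 is at most `(12/π²) h_K R_K/√D` when `d = D > 16`:**
`(6/π²)·L(1,χ)/Σ' 1/a ≤ (6/π²)·L(1,χ) = (6/π²)·2h_K R_K/√D` by `Σ' 1/a ≥ 1` (`one_le_formSum_pos`) and
the class number formula (`SiegelZeroClassNumber.lOne_re_eq_of_even`), for the real quadratic field `K`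
with `d_K = D`. [cite: GoldfeldSchinzel1975, Theorem 1 p. 571 with §4 p. 583]
[cite: NeukirchANT1999, Ch. VII §5 (5.11)] -/
theorem mainTerm_le_even {D : ℕ} [NeZero D] {χ : DirichletCharacter ℂ D}
    (hprim : χ.IsPrimitive) (hquad : χ.IsQuadratic) (heven : χ.Even) (hD : 16 < D)
    (K : Type*) [Field K] [NumberField K] (h2 : Module.finrank ℚ K = 2)
    (hdK : NumberField.discr K = (D : ℤ)) :
    6 / Real.pi ^ 2 * (χ.LFunction 1).re / formSum (D : ℤ) ≤
      12 / Real.pi ^ 2 * (NumberField.classNumber K * NumberField.Units.regulator K) / Real.sqrt D := by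
  have hD1 : 1 < D := lt_trans (by norm_num) hD
  have hre := SiegelZeroClassNumber.lOne_re_eq_of_even h2 hdK hD1 hprim hquad heven
  -- `D ≡ 0, 1 (mod 4)`
  have hfund := Quadratic.isFundamentalDiscriminant_discr (K := K) h2
  rw [hdK] at hfund
  have h4 : 4 ∣ (D : ℤ) ∨ (D : ℤ) % 4 = 1 := by
    rcases hfund with ⟨h1, -, -⟩ | ⟨h0, -, -⟩
    · right; omega
    · left; exact h0
  have hF1 := one_le_formSum_pos hD h4
  have hπ := Real.pi_pos
  have hh : (0 : ℝ) < NumberField.classNumber K := by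
    exact_mod_cast NumberField.classNumber_pos (K := K)
  have hR : 0 < NumberField.Units.regulator K := NumberField.Units.regulator_pos K
  have hL0 : 0 ≤ (χ.LFunction 1).re := by rw [hre]; positivity
  have hstep : (χ.LFunction 1).re / formSum (D : ℤ) ≤ (χ.LFunction 1).re := div_le_self hL0 hF1
  calc 6 / Real.pi ^ 2 * (χ.LFunction 1).re / formSum (D : ℤ)
      = 6 / Real.pi ^ 2 * ((χ.LFunction 1).re / formSum (D : ℤ)) := by ring
    _ ≤ 6 / Real.pi ^ 2 * (χ.LFunction 1).re := by gcongr
    _ = 12 / Real.pi ^ 2 * (NumberField.classNumber K * NumberField.Units.regulator K) /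
          Real.sqrt D := by
        rw [hre]; ring

-- budgeted above the tree default (long threshold bookkeeping), on the buildfix lane's advice
set_option maxHeartbeats 400000 in
/-- **Goldfeld–Schinzel's Theorem 1 read as an UPPER bound for the distance of the Siegel zero from
`1` in terms of `h_K R_K`, case `d > 0` (modulo the named fact `goldfeldSchinzel1975_theorem1`):** for
every `η > 0` there is an effective `c` such that for every even primitive quadratic `χ` mod `D > c`,
every real zero `β` of `L(s, χ)` with `1 − β < (log D)⁻²`, and the real quadratic field `K` with
`d_K = D`, **`1 − β ≤ (12/π² + η) · h_K R_K/√D`**. From Theorem 1: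
`1 − β ≤ M(1 + C((log log D)²/log D + 1/log D)) ≤ M(1 + π²η/12)` and `M ≤ (12/π²) h_K R_K/√D`
(`mainTerm_le_even`); the window condition `1 − c₁/log D < β` follows from `1 − β < (log D)⁻² ≤ c₁/log D`
once `log D ≥ 1/c₁`. The «small `h_K R_K` ⇒ `β` close to `1`» direction of topic I.1 for real quadratic
fields; nothing here asserts that such a zero exists.
[cite: GoldfeldSchinzel1975, Theorem 1 p. 571 (1)–(2) with §4 p. 583 (L(1,χ) = h₀ log ε₀/√d)]
[cite: NeukirchANT1999, Ch. VII §5 (5.11)] -/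
theorem one_sub_le_classNumber_mul_regulator_of_theorem1 (h : goldfeldSchinzel1975_theorem1) {η : ℝ}
    (hη : 0 < η) :
    ∃ c : ℕ, ∀ (D : ℕ) [NeZero D], c < D →
      ∀ χ : DirichletCharacter ℂ D, χ.IsQuadratic → χ.IsPrimitive → χ.Even →
        ∀ β : ℝ, χ.LFunction (β : ℂ) = 0 → 1 - β < 1 / Real.log D ^ 2 →
          ∀ (K : Type) [Field K] [NumberField K], Module.finrank ℚ K = 2 →
            NumberField.discr K = (D : ℤ) →
              1 - β ≤ (12 / Real.pi ^ 2 + η) *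
                (NumberField.classNumber K * NumberField.Units.regulator K) / Real.sqrt D := by
  obtain ⟨c₁, hc₁, C, D₀, hT⟩ := h
  have hπ := Real.pi_pos
  set C' : ℝ := max C 0 with hC'
  have hC'0 : 0 ≤ C' := le_max_right _ _
  have hCC' : C ≤ C' := le_max_left _ _
  -- thresholds: `1/log D ≤ c₁` and `C'·((log log D)²/log D + 1/log D) ≤ π²η/12`
  obtain ⟨N₁, hN₁⟩ := exists_nat_forall_lt_of_tendsto'
    (tendsto_inv_atTop_zero.comp Real.tendsto_log_atTop) hc₁
  obtain ⟨N₃, hN₃⟩ := exists_nat_forall_lt_of_tendsto'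
    (by simpa using tendsto_loglog_sq_div_log_add_inv_log'.const_mul C')
    (by positivity : 0 < Real.pi ^ 2 * η / 12)
  refine ⟨max (max D₀ 16) (max N₁ N₃), fun D _ hcD χ hquad hprim heven β hβ hsmall K _ _ h2 hdK => ?_⟩
  simp only [max_lt_iff] at hcD
  obtain ⟨⟨hD₀, hD16⟩, hD₁, hD₃⟩ := hcD
  have hD1 : (1 : ℝ) < D := by exact_mod_cast (lt_trans (by norm_num) hD16 : 1 < D)
  have hsqrt : 0 < Real.sqrt D := Real.sqrt_pos.mpr (by positivity)
  have hlog : 0 < Real.log D := Real.log_pos hD1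
  have hχ1 : χ ≠ 1 := ne_one_of_isPrimitive' hprim (lt_trans (by norm_num) hD16)
  have hβ1 : β < 1 := lt_one_of_LFunction_eq_zero' hχ1 hβ
  -- the zero is in the window of Theorem 1: `1 − β < (log D)⁻² ≤ c₁/log D`
  have hwin : 1 - c₁ / Real.log D < β := by
    have h1 : (Real.log D)⁻¹ < c₁ := by simpa using hN₁ D hD₁.le
    have h2' : 1 / Real.log D ^ 2 ≤ c₁ / Real.log D := by
      rw [div_le_div_iff₀ (by positivity) hlog]
      have : (Real.log D)⁻¹ * Real.log D = 1 := inv_mul_cancel₀ hlog.ne'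
      nlinarith
    linarith
  have hE3 : C' * (Real.log (Real.log D) ^ 2 / Real.log D + (Real.log D)⁻¹) ≤ Real.pi ^ 2 * η / 12 :=
    (hN₃ D hD₃.le).le
  have key := hT D hD₀.le χ hquad hprim β hwin hβ1 hβ
  rw [signedDisc_of_not_odd heven.not_odd] at key
  set M : ℝ := 6 / Real.pi ^ 2 * (χ.LFunction 1).re / formSum (D : ℤ) with hM
  set ℓ : ℝ := Real.log (Real.log D) ^ 2 / Real.log D with hℓ
  have hℓ0 : 0 ≤ ℓ := by positivity
  have hup : 1 - β ≤ M + M * C * (ℓ + (1 - β) * Real.log D) := by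
    have := (abs_le.mp key).2
    linarith
  set HR : ℝ := NumberField.classNumber K * NumberField.Units.regulator K with hHR
  have hHR0 : 0 ≤ HR := by
    have hh : (0 : ℝ) < NumberField.classNumber K := by
      exact_mod_cast NumberField.classNumber_pos (K := K)
    have hR : 0 < NumberField.Units.regulator K := NumberField.Units.regulator_pos K
    positivity
  have hMle : M ≤ 12 / Real.pi ^ 2 * HR / Real.sqrt D :=
    mainTerm_le_even hprim hquad heven hD16 K h2 hdK
  have hM0 : 0 ≤ M := by
    have hre := SiegelZeroClassNumber.lOne_re_eq_of_even h2 hdK (lt_trans (by norm_num) hD16) hprim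
      hquad heven
    have hh : (0 : ℝ) < NumberField.classNumber K := by
      exact_mod_cast NumberField.classNumber_pos (K := K)
    have hR : 0 < NumberField.Units.regulator K := NumberField.Units.regulator_pos K
    have hL0 : 0 ≤ (χ.LFunction 1).re := by
      rw [hre]
      positivity
    rw [hM]
    exact div_nonneg (mul_nonneg (by positivity) hL0) (formSum_nonneg _)
  have hprod : (1 - β) * Real.log D ≤ (Real.log D)⁻¹ := by
    have : (1 - β) * Real.log D < 1 / Real.log D ^ 2 * Real.log D :=
      mul_lt_mul_of_pos_right hsmall hlog
    rw [show 1 / Real.log D ^ 2 * Real.log D = (Real.log D)⁻¹ by field_simp] at this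
    exact this.le
  have herr : M * C * (ℓ + (1 - β) * Real.log D) ≤ M * (Real.pi ^ 2 * η / 12) := by
    have hnn : 0 ≤ ℓ + (1 - β) * Real.log D := by
      have : 0 ≤ (1 - β) * Real.log D := mul_nonneg (by linarith) hlog.le
      linarith
    calc M * C * (ℓ + (1 - β) * Real.log D) ≤ M * C' * (ℓ + (1 - β) * Real.log D) := by
          gcongr
      _ = M * (C' * (ℓ + (1 - β) * Real.log D)) := by ring
      _ ≤ M * (C' * (ℓ + (Real.log D)⁻¹)) := by gcongr
      _ ≤ M * (Real.pi ^ 2 * η / 12) := by gcongr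
  calc 1 - β ≤ M + M * C * (ℓ + (1 - β) * Real.log D) := hup
    _ ≤ M + M * (Real.pi ^ 2 * η / 12) := by linarith
    _ = M * (1 + Real.pi ^ 2 * η / 12) := by ring
    _ ≤ 12 / Real.pi ^ 2 * HR / Real.sqrt D * (1 + Real.pi ^ 2 * η / 12) := by gcongr
    _ = (12 / Real.pi ^ 2 + η) * HR / Real.sqrt D := by
        field_simp

/-- **`1 − β ≤ (12/π² + η) h_K R_K/√D`, unconditionally**, for the real zeros with `1 − β < (log D)⁻²`
of a primitive quadratic even `χ` mod `D > c(η)` and the real quadratic field `K` with `d_K = D`.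
[cite: GoldfeldSchinzel1975, Theorem 1 p. 571 (1)–(2) with §4 p. 583] [cite: NeukirchANT1999, Ch. VII §5 (5.11)] -/
theorem one_sub_le_classNumber_mul_regulator {η : ℝ} (hη : 0 < η) :
    ∃ c : ℕ, ∀ (D : ℕ) [NeZero D], c < D →
      ∀ χ : DirichletCharacter ℂ D, χ.IsQuadratic → χ.IsPrimitive → χ.Even →
        ∀ β : ℝ, χ.LFunction (β : ℂ) = 0 → 1 - β < 1 / Real.log D ^ 2 →
          ∀ (K : Type) [Field K] [NumberField K], Module.finrank ℚ K = 2 →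
            NumberField.discr K = (D : ℤ) →
              1 - β ≤ (12 / Real.pi ^ 2 + η) *
                (NumberField.classNumber K * NumberField.Units.regulator K) / Real.sqrt D :=
  one_sub_le_classNumber_mul_regulator_of_theorem1 goldfeldSchinzel1975_theorem1_holds hη

/-! ### Every real zero of an even character is `> C/√D` away from `1`; Pintz's Theorem 3 for `d > 0` -/

/-- **For EVEN primitive quadratic characters, every real zero is farther than `C/√D` from `1`** once
`D ≥ D₀(C)` (any real `C`): `1 − β ≥ (3/π²) log D/√D > C/√D` by `corollary_even` with `η = 3/π²` and
`log D → ∞`. [cite: GoldfeldSchinzel1975, Corollary p. 572 (case d > 0)] -/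
theorem const_div_sqrt_lt_one_sub_of_even (C : ℝ) :
    ∃ D₀ : ℕ, ∀ (D : ℕ) [NeZero D], D₀ ≤ D →
      ∀ χ : DirichletCharacter ℂ D, χ.IsQuadratic → χ.IsPrimitive → χ.Even →
        ∀ β : ℝ, χ.LFunction (β : ℂ) = 0 → C / Real.sqrt D < 1 - β := by
  have hπ := Real.pi_pos
  obtain ⟨c, hc⟩ := corollary_even (by positivity : (0 : ℝ) < 3 / Real.pi ^ 2)
  obtain ⟨N, hN⟩ := exists_nat_forall_log_gt (C * Real.pi ^ 2 / 3)
  refine ⟨max (c + 1) N, fun D _ hD χ hquad hprim heven β hβ => ?_⟩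
  have hcD : c < D := by have := le_max_left (c + 1) N; omega
  have hND : N ≤ D := le_trans (le_max_right _ _) hD
  have h := hc D hcD χ hquad hprim heven β hβ
  have hlogD : C * Real.pi ^ 2 / 3 < Real.log D := hN D hND
  have hD0 : (0 : ℝ) < D := by exact_mod_cast (lt_of_le_of_lt (Nat.zero_le c) hcD)
  have hsqrt : 0 < Real.sqrt D := Real.sqrt_pos.mpr hD0
  have hC : C < (6 / Real.pi ^ 2 - 3 / Real.pi ^ 2) * Real.log D := by
    rw [div_lt_iff₀ (by positivity)] at hlogD
    have e : (6 / Real.pi ^ 2 - 3 / Real.pi ^ 2) * Real.log D = Real.log D * 3 / Real.pi ^ 2 := by ring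
    rw [e, lt_div_iff₀ (by positivity)]
    linarith
  calc C / Real.sqrt D < (6 / Real.pi ^ 2 - 3 / Real.pi ^ 2) * Real.log D / Real.sqrt D :=
        div_lt_div_of_pos_right hC hsqrt
    _ ≤ 1 - β := h

end GoldfeldSchinzel1975

/-- **Pintz 1976 (II), Theorem 3 — the EVEN-character half, unconditionally** (a reading of the
named fact `pintz1976_theorem3` of `GreatestRealZeroElementary.lean` restricted to `χ(−1) = 1`): for
every `ε` there is `D₀` such that for `D ≥ D₀`, every even primitive quadratic `χ` mod `D` and every
greatest real zero `β` (indeed every real zero), `(12/π − ε)/√D ≤ 1 − β` — immediate from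
Goldfeld–Schinzel's Corollary for `d > 0`, whose `log d` gain dominates any constant. The odd half
(`d < 0`, constant `12/π` via Pintz's Theorem 2 and class number `≥ 3`) is not touched.
[cite: Pintz1976ElementaryII, Theorem 3 p. 277 (1.24)] [cite: GoldfeldSchinzel1975, Corollary p. 572] -/
theorem pintz1976_theorem3_even (ε : ℝ) :
    ∃ D₀ : ℕ, ∀ (D : ℕ) [NeZero D], D₀ ≤ D →
      ∀ χ : DirichletCharacter ℂ D, χ.IsQuadratic → χ.IsPrimitive → χ.Even →
        ∀ β : ℝ, Pintz1976.IsGreatestRealZero χ β → (12 / Real.pi - ε) / Real.sqrt D ≤ 1 - β := by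
  obtain ⟨D₀, h⟩ := GoldfeldSchinzel1975.const_div_sqrt_lt_one_sub_of_even (12 / Real.pi - ε)
  exact ⟨D₀, fun D _ hD χ hquad hprim heven β hβ => (h D hD χ hquad hprim heven β hβ.2.1).le⟩

/-- **Schinzel's footnote to Pintz's Theorem 3 (`16/π`) — the EVEN-character half, unconditionally**
(a reading of the named fact `pintz1976_theorem3_schinzel` restricted to `χ(−1) = 1`): for every `ε`
there is `D₀` with `(16/π − ε)/√D < 1 − β` for `D ≥ D₀`, every even primitive quadratic `χ` mod `D`
and every greatest real zero `β`. [cite: Pintz1976ElementaryII, footnote (2) p. 277]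
[cite: GoldfeldSchinzel1975, Corollary p. 572] -/
theorem pintz1976_theorem3_schinzel_even (ε : ℝ) :
    ∃ D₀ : ℕ, ∀ (D : ℕ) [NeZero D], D₀ ≤ D →
      ∀ χ : DirichletCharacter ℂ D, χ.IsQuadratic → χ.IsPrimitive → χ.Even →
        ∀ β : ℝ, Pintz1976.IsGreatestRealZero χ β → (16 / Real.pi - ε) / Real.sqrt D < 1 - β := by
  obtain ⟨D₀, h⟩ := GoldfeldSchinzel1975.const_div_sqrt_lt_one_sub_of_even (16 / Real.pi - ε)
  exact ⟨D₀, fun D _ hD χ hquad hprim heven β hβ => h D hD χ hquad hprim heven β hβ.2.1⟩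

/-- **Goldfeld–Schinzel 1975, Corollary — DISCHARGED** (`goldfeldSchinzel1975_corollary` of
`SiegelZeroFormSumAsymptotic.lean`): for every `η > 0` there is `c(η)` such that for every primitive
quadratic `χ` mod `D > c(η)` and every real `β` with `L(β, χ) = 0`,
`χ odd → (6/π − η)/√D ≤ 1 − β` and `χ even → (6/π² − η) log D/√D ≤ 1 − β`
(`GoldfeldSchinzel1975.corollary_odd`, `GoldfeldSchinzel1975.corollary_even`).
[cite: GoldfeldSchinzel1975, Corollary p. 572, proof §4 pp. 582–583] -/
theorem goldfeldSchinzel1975_corollary_holds : goldfeldSchinzel1975_corollary := by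
  intro η hη
  obtain ⟨c₁, hc₁⟩ := GoldfeldSchinzel1975.corollary_odd hη
  obtain ⟨c₂, hc₂⟩ := GoldfeldSchinzel1975.corollary_even hη
  refine ⟨max c₁ c₂, fun D _ hD χ hquad hprim β hβ => ⟨fun hodd => ?_, fun heven => ?_⟩⟩
  · exact hc₁ D (lt_of_le_of_lt (le_max_left _ _) hD) χ hquad hprim hodd β hβ
  · exact hc₂ D (lt_of_le_of_lt (le_max_right _ _) hD) χ hquad hprim heven β hβ

end Literature.NumberTheory.LFunctions

end
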